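import Summits.ABC.IUTFork.Thm311Sig
import Literature.IUT.HodgeTheaters.InitialThetaData
import Literature.NumberTheory.DiophantineGeometry.LocalReductionFiniteBadPlacesProofs
import Literature.IUT.LogVolume.FakeAdeleIndex
import Literature.IUT.LogThetaLattice.LocalLogShells
import Mathlib.NumberTheory.NumberField.Completion.InfinitePlace
import Mathlib.RingTheory.DedekindDomain.AdicValuation
import Mathlib.RingTheory.Ideal.GoingUp
import Mathlib.Algebra.CharP.Algebra
import HarnessLib

/-!
# [IUTchIII] Theorem 3.11 over real definitions, M: the index skeleton from INITIAL Θ-DATA as typed by campaign M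

Record-only file (D-0012) of the abc-iut cell (Cor. 3.12 sub-crew, wave-2 seat abc-iut-c312-5, board row
W2-A); TAKES NO SIDE on [IUTchIII] Cor. 3.12. `Thm311Real.lean` instantiated abc-iut-c312-1's index
skeleton `Thm311.ThetaIndex` at the Dupuy–Hilado level (from `Literature.IUT.LogVolume.PilotData`). This
file instantiates it at the M level, i.e. from **[IUTchI] Definition 3.1 itself as typed by
abc-iut-L5-t2** (`Literature.IUT.HodgeTheaters.InitialThetaData F K Fbar E l P`, clauses (a)–(f), over the
§0 vocabulary `Val` of abc-iut-L5-t1's `ConventionsNumbers.lean`):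

* `V := V̲` — the SECTION `V̲ ⊆ V(K)` of `V(K) ↠ V_mod` of Def. 3.1 (e) (field `D.V`, with `D.V_bijOn`);
* `V_ℚ := V(ℚ)` (`Val ℚ`), `v ↦ v_ℚ :=` the place of `ℚ` under `v_mod := toVMod v ∈ V_mod = V(F_mod)`
  (`Val.restrict ℚ`), `V^non_ℚ` = `Val.IsNon`;
* `V^bad := V̲^bad` — "the members of `V̲` lying over `V^bad_mod`" (L5-t2's `D.Vbad`), nonempty because
  `V^bad_mod ≠ ∅` (Def. 3.1 (b)) and nonarchimedean because `V^bad_mod ⊆ V(F_mod)^non`;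
* `l⋇ := (l − 1)/2` from Def. 3.1 (c) "`l ≥ 5` prime".

Proved here (Mathlib): the fibres of the restriction of valuations `V(M) → V(L)` along a finite
extension of number fields are FINITE and NONEMPTY (`fibre_restrict_finite/nonempty`: finitely many
archimedean places; `primesOver` finite; `InfinitePlace.comap_surjective`; going-up
`exists_maximal_ideal_liesOver_of_isIntegral`) — whence the fibres of `V̲ → V_ℚ` through the bijection
`V̲ ⥲ V_mod`.

RESIDUAL / MODELLING NOTES (neutral). (1) Def. 3.1 (b) prints "`V^bad_mod` … a nonempty set of
nonarchimedean valuations" without the word finite; finiteness FOLLOWS — and is PROVED here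
(`vbadMod_finite`) — from L5-t2's `multiplicative_over_VbadMod` and the tree's THEOREM
`WeierstrassCurve.finite_badPlaces_holds` (finitely many places of bad reduction, Silverman AEC VIII.1
Rmk 1.3, `LocalReductionFiniteBadPlacesProofs.lean`), via the surjectivity of `V(F) → V(F_mod)` (§1); so the
M-level index instance has NO hypothesis beyond the initial Θ-data `D`. (2) `v ↦ v_ℚ` is computed through `v_mod`
(restriction in the tower `K ⊇ F ⊇ F_mod ⊇ ℚ`), which is the place of `ℚ` under `v`; the transitivity
lemma identifying it with the direct restriction `V(K) → V(ℚ)` is not needed by Thm. 3.11 and not proved.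
(3) §3 gives the mono-analytic log-shell carriers over THIS index skeleton exactly as `Thm311Real` §3 does over
pilot data: `K_v :=` Mathlib's completion at the place `v ∈ V̲ ⊆ V(K)` (`InfinitePlace.Completion`, resp.
`adicCompletion` at the prime `w.maximalIdeal` of a finite place `w` — isomorphic to L5-t1's
`Val.Completion`, the completion for the place's absolute value; the identification is not needed), shells
from abc-iut-L6-t3's `nonarchLogShell` / `arcLogShell`, the automorphism slots and the `p_v`-adic logarithms as
BINDERS with the owners listed in `Thm311Real` (L4-t3 / L6-t1 / L6-t3 / S1).

Sources read on the page: [IUTchI] pp. 61–62 (Def. 3.1 (a)–(e)); [IUTchIII] p. 153 (Thm. 3.11: "Fix a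
collection of initial Θ-data … as in [IUTchI], Definition 3.1"). [claim: Mochizuki2012, status: disputed]
NOT here: log-shells, packets (sequel); any judgement. typed ≠ discharged; instantiated ≠ endorsed.
-/

noncomputable section

namespace Summit.ABC.IUTFork.Thm311.Real

open NumberField IsDedekindDomain Literature.IUT.HodgeTheaters

/-! ## 1. Fibres of the restriction of valuations along a finite extension of number fields -/

section Fibres

variable (L : Type) {M : Type} [Field L] [NumberField L] [Field M] [NumberField M] [Algebra L M]

/-- Restriction sends an archimedean valuation to the archimedean valuation below it
(`InfinitePlace.comap`). [folklore] -/
theorem restrict_arc (w : InfinitePlace M) :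
    Val.restrict L (Val.arc w) = Val.arc (w.comap (algebraMap L M)) := rfl

/-- Restriction sends a nonarchimedean valuation to the finite place of the prime below it
(`HeightOneSpectrum.under`). [folklore] -/
theorem restrict_non (w : FinitePlace M) :
    Val.restrict L (Val.non w) = Val.non (FinitePlace.mk ((FinitePlace.maximalIdeal w).under (𝓞 L))) := rfl

/-- The fibre of `V(M) → V(L)` over an archimedean valuation consists of archimedean valuations.
[folklore] -/
theorem fibre_restrict_arc_subset (u : InfinitePlace L) :
    {w : Val M | Val.restrict L w = Val.arc u} ⊆ Set.range Val.arc := by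
  rintro (w | w) hw
  · exact ⟨w, rfl⟩
  · change Sum.inr (FinitePlace.mk ((FinitePlace.maximalIdeal w).under (𝓞 L))) = Sum.inl u at hw
    exact absurd hw Sum.inr_ne_inl

/-- The fibre of `V(M) → V(L)` over a nonarchimedean valuation `u` consists of the finite places of the
primes of `𝓞 M` over the prime of `u`. [folklore] -/
theorem fibre_restrict_non_subset (u : FinitePlace L) :
    {w : Val M | Val.restrict L w = Val.non u} ⊆
      Val.non '' (FinitePlace.mk ''
        ((fun v : HeightOneSpectrum (𝓞 M) => v.asIdeal) ⁻¹'
          (FinitePlace.maximalIdeal u).asIdeal.primesOver (𝓞 M))) := by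
  rintro (w | w) hw
  · change Sum.inl (w.comap (algebraMap L M)) = Sum.inr u at hw
    exact absurd hw Sum.inl_ne_inr
  · change Sum.inr (FinitePlace.mk ((FinitePlace.maximalIdeal w).under (𝓞 L))) = Sum.inr u at hw
    have hw' : (FinitePlace.maximalIdeal w).under (𝓞 L) = FinitePlace.maximalIdeal u := by
      have h1 := Sum.inr_injective hw
      rw [← FinitePlace.mk_maximalIdeal u, FinitePlace.mk_eq_iff] at h1
      exact h1
    refine ⟨w, ⟨FinitePlace.maximalIdeal w, ?_, FinitePlace.mk_maximalIdeal w⟩, rfl⟩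
    refine ⟨(FinitePlace.maximalIdeal w).isPrime, ⟨?_⟩⟩
    rw [← hw']
    rfl

/-- **The fibres of `V(M) → V(L)` are finite**: finitely many archimedean valuations of `M`; finitely
many primes of `𝓞 M` over a given prime of `𝓞 L` (Mathlib `primesOver_finite`). [folklore] -/
theorem fibre_restrict_finite (u : Val L) : {w : Val M | Val.restrict L w = u}.Finite := by
  rcases u with u | u
  · exact (Set.finite_range _).subset (fibre_restrict_arc_subset L u)
  · refine Set.Finite.subset ?_ (fibre_restrict_non_subset L u)
    haveI := (FinitePlace.maximalIdeal u).isMaximal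
    refine ((Set.Finite.preimage (fun _ _ _ _ h => HeightOneSpectrum.ext h) ?_).image _).image _
    exact IsDedekindDomain.primesOver_finite _ _

/-- The algebra map `𝓞 L → 𝓞 M` is injective (Mathlib `RingOfIntegers.algebraMap.injective`), as a
`FaithfulSMul` instance for the going-up lemma below. [folklore] -/
instance faithfulSMul_ringOfIntegers : FaithfulSMul (𝓞 L) (𝓞 M) :=
  (faithfulSMul_iff_algebraMap_injective (𝓞 L) (𝓞 M)).mpr (RingOfIntegers.algebraMap.injective L M)

/-- **The fibres of `V(M) → V(L)` are nonempty**: every archimedean valuation of `L` extends to `M`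
(`InfinitePlace.comap_surjective`); over every prime of `𝓞 L` lies a prime of `𝓞 M` (going up,
`Ideal.exists_maximal_ideal_liesOver_of_isIntegral`). [folklore] -/
theorem fibre_restrict_nonempty (u : Val L) : ∃ w : Val M, Val.restrict L w = u := by
  rcases u with u | u
  · obtain ⟨w, rfl⟩ := InfinitePlace.comap_surjective (K := M) u
    exact ⟨Val.arc w, rfl⟩
  · haveI := (FinitePlace.maximalIdeal u).isMaximal
    obtain ⟨P, hP, hPover⟩ :=
      Ideal.exists_maximal_ideal_liesOver_of_isIntegral (S := 𝓞 M) (FinitePlace.maximalIdeal u).asIdeal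
    have hPne : P ≠ ⊥ :=
      Ideal.ne_bot_of_liesOver_of_ne_bot (FinitePlace.maximalIdeal u).ne_bot P
    let v : HeightOneSpectrum (𝓞 M) := ⟨P, hP.isPrime, hPne⟩
    have hv : v.under (𝓞 L) = FinitePlace.maximalIdeal u :=
      HeightOneSpectrum.ext hPover.over.symm
    refine ⟨Val.non (FinitePlace.mk v), ?_⟩
    rw [restrict_non, FinitePlace.maximalIdeal_mk, hv, FinitePlace.mk_maximalIdeal]
    rfl

end Fibres

/-! ## 2. The index skeleton of Theorem 3.11 from initial Θ-data ([IUTchI] Def. 3.1, L5-t2's typing) -/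

section OfInitial

variable {F K Fbar : Type} [Field F] [NumberField F] [Field K] [NumberField K] [Algebra F K]
  [Field Fbar] [Algebra F Fbar] [Algebra K Fbar] {E : WeierstrassCurve F} [E.IsElliptic] {l : ℕ}
  {P : BadPlacePredicates K} (D : InitialThetaData F K Fbar E l P)

/-- `l⋇ := (l − 1)/2` for the prime `l` of the initial Θ-data ([IUTchI] Introduction p. 3 l. 63–64; Def. 3.1 (c)).
[folklore] -/
def lstarOf (_D : InitialThetaData F K Fbar E l P) : ℕ := (l - 1) / 2

/-- Since `l ≥ 5` is prime (Def. 3.1 (c)), `l = 2l⋇ + 1`. [folklore] -/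
theorem l_eq_two_mul_lstarOf_add_one : l = 2 * lstarOf D + 1 := by
  have h5 := D.five_le_l
  have hodd : ¬ 2 ∣ l := by
    intro h
    rcases D.l_prime.eq_one_or_self_of_dvd 2 h with h | h <;> omega
  unfold lstarOf
  omega

/-- Since `l ≥ 5`, `l⋇ ≥ 2`. [folklore] -/
theorem two_le_lstarOf : 2 ≤ lstarOf D := by
  have h5 := D.five_le_l
  unfold lstarOf
  omega

/-- `v ↦ v_ℚ` on `V̲`: the place of `ℚ` under `v_mod = toVMod v ∈ V_mod = V(F_mod)` (restriction of
valuations in the tower `K ⊇ F ⊇ F_mod ⊇ ℚ`; [IUTchIII] Rmk. 3.1.1 (ii) "`v ∈ V̲` lying over `v_ℚ`").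
[claim: Mochizuki2012, status: disputed] -/
def underQ (v : ↥D.V) : Val ℚ := Val.restrict ℚ (toVMod F K E (v : Val K))

/-- The fibre of `V̲ → V_ℚ` over `v_ℚ` is the preimage, under the bijection `V̲ ⥲ V_mod`, of the fibre of
`V_mod → V_ℚ`. [folklore] -/
theorem fibre_underQ_eq (vQ : Val ℚ) :
    {v : ↥D.V | underQ D v = vQ} =
      (fun v : ↥D.V => toVMod F K E (v : Val K)) ⁻¹'
        {u : Val (fieldOfModuli E) | Val.restrict ℚ u = vQ} := rfl

/-- The finite place of `F_mod` below a finite place of `F` (restriction of valuations on `V^non`). [folklore] -/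
def finBelow (v : FinitePlace F) : FinitePlace (fieldOfModuli E) :=
  FinitePlace.mk ((FinitePlace.maximalIdeal v).under (𝓞 (fieldOfModuli E)))

omit [NumberField K] [Algebra F K] [Algebra F Fbar] [Algebra K Fbar] in
/-- Restriction of a nonarchimedean valuation of `F` to `F_mod` is `finBelow`. [folklore] -/
theorem restrict_non_eq_finBelow (v : FinitePlace F) :
    Val.restrict (fieldOfModuli E) (Val.non v) = Val.non (finBelow (E := E) v) := rfl

/-- **`V^bad_mod` is finite** ([IUTchI] Def. 3.1 (b) does not say so; it follows): every `w ∈ V^bad_mod` lies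
under some finite place `v` of `F` (§1, going up), at which `E_F` has multiplicative — hence not good —
reduction (L5-t2's `multiplicative_over_VbadMod`), and the places of bad reduction of an elliptic curve are
finite (the tree's `WeierstrassCurve.finite_badPlaces_holds`, Silverman AEC VIII.1 Rmk. 1.3).
[folklore] -/
theorem vbadMod_finite : D.VbadMod.Finite := by
  have hbad : (E.badPlaces (𝓞 F)).Finite := WeierstrassCurve.finite_badPlaces_holds (𝓞 F) E
  have hpre : {v : FinitePlace F | FinitePlace.maximalIdeal v ∈ E.badPlaces (𝓞 F)}.Finite :=
    Set.Finite.preimage (fun _ _ _ _ h => FinitePlace.maximalIdeal_injective h) hbad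
  refine (hpre.image (finBelow (E := E))).subset ?_
  intro w hw
  obtain ⟨x, hx⟩ := fibre_restrict_nonempty (fieldOfModuli E) (M := F) (Val.non w)
  rcases x with u | v
  · change Sum.inl (u.comap (algebraMap (fieldOfModuli E) F)) = Sum.inr w at hx
    exact absurd hx Sum.inl_ne_inr
  · have hvw : finBelow (E := E) v = w := Sum.inr_injective hx
    refine ⟨v, ?_, hvw⟩
    show FinitePlace.maximalIdeal v ∈ E.badPlaces (𝓞 F)
    rw [WeierstrassCurve.mem_badPlaces_iff]
    refine WeierstrassCurve.HasMultiplicativeReductionAt.not_hasGoodReductionAt ?_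
    refine D.multiplicative_over_VbadMod v ?_
    rw [restrict_non_eq_finBelow, hvw]
    exact ⟨w, hw, rfl⟩

/-- **`Thm311.ThetaIndex` INSTANTIATED FROM INITIAL Θ-DATA** ([IUTchI] Def. 3.1 as typed by abc-iut-L5-t2;
[IUTchIII] Thm. 3.11 p. 153 "Fix a collection of initial Θ-data `(F̄/F, X_F, l, C̲_K, V̲, V^bad_mod, ε̲)` as
in [IUTchI], Definition 3.1"): `l⋇ = (l−1)/2`, `V := V̲` (the section of (e)), `V_ℚ := V(ℚ)`,
`v ↦ v_ℚ` through `V_mod`, `V^non_ℚ` = the nonarchimedean valuations of `ℚ`, fibres finite and nonempty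
(§1 through the bijection `V̲ ⥲ V_mod` of (e)), `V^bad := V̲^bad` (L5-t2's `D.Vbad`: "the members of `V̲`
lying over `V^bad_mod`"), nonempty by (b) "`V^bad_mod` … nonempty", nonarchimedean because
`V^bad_mod ⊆ V(F_mod)^non`, finite by `vbadMod_finite` (module docstring (1)). NO hypothesis beyond `D`.
[claim: Mochizuki2012, status: disputed] -/
def thetaIndexOfInitial : ThetaIndex where
  lstar := lstarOf D
  two_le_lstar := two_le_lstarOf D
  V := ↥D.V
  VQ := Val ℚ
  over := underQ D
  IsNon := Val.IsNon
  fibre_finite vQ := by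
    rw [fibre_underQ_eq]
    refine Set.Finite.preimage (fun x _ y _ h => Subtype.ext (D.V_bijOn.injOn x.2 y.2 h)) ?_
    exact fibre_restrict_finite ℚ vQ
  fibre_nonempty vQ := by
    obtain ⟨u, hu⟩ := fibre_restrict_nonempty ℚ (M := fieldOfModuli E) vQ
    exact ⟨⟨D.underline u, D.underline_mem u⟩, by
      show Val.restrict ℚ (toVMod F K E (D.underline u)) = vQ
      rw [D.toVMod_underline u, hu]⟩
  Vbad := {v : ↥D.V | (v : Val K) ∈ D.Vbad}
  Vbad_nonempty := by
    obtain ⟨w, hw⟩ := D.VbadMod_nonempty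
    refine ⟨⟨D.underline (Val.non w), D.underline_mem _⟩, ?_⟩
    show D.underline (Val.non w) ∈ D.Vbad
    exact ⟨D.underline_mem _, by rw [D.toVMod_underline]; exact ⟨w, hw, rfl⟩⟩
  Vbad_finite := by
    have hVb : {v : ↥D.V | (v : Val K) ∈ D.Vbad} =
        (fun v : ↥D.V => toVMod F K E (v : Val K)) ⁻¹' (Val.non '' D.VbadMod) := by
      ext v
      exact ⟨fun h => h.2, fun h => ⟨v.2, h⟩⟩
    rw [hVb]
    exact Set.Finite.preimage (fun x _ y _ h => Subtype.ext (D.V_bijOn.injOn x.2 y.2 h))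
      ((vbadMod_finite D).image _)
  Vbad_non := by
    rintro v ⟨_, ⟨w, _, hw⟩⟩
    show Val.IsNon (Val.restrict ℚ (toVMod F K E (v : Val K)))
    rw [← hw]
    rfl


/-- The instantiated `l = 2l⋇ + 1` IS the prime `l` of the initial Θ-data. [folklore] -/
theorem thetaIndexOfInitial_l : (thetaIndexOfInitial D).l = l := by
  show 2 * lstarOf D + 1 = l
  exact (l_eq_two_mul_lstarOf_add_one D).symm

/-- The instantiated `V` IS the section `V̲ ⊆ V(K)` of [IUTchI] Def. 3.1 (e). [claim: Mochizuki2012, status: disputed] -/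
theorem thetaIndexOfInitial_V : (thetaIndexOfInitial D).V = ↥D.V := rfl

/-- The instantiated `V` is in bijection with `V_mod` (Def. 3.1 (e): "a natural bijection `V̲ ⥲ V_mod`").
[claim: Mochizuki2012, status: disputed] -/
def vEquivVMod : (thetaIndexOfInitial D).V ≃ Val (fieldOfModuli E) :=
  (D.V_bijOn.equiv (toVMod F K E)).trans (Equiv.Set.univ _)

/-- `v ∈ V^bad` iff `v ∈ V̲^bad` (L5-t2), i.e. `v_mod ∈ V^bad_mod`. [claim: Mochizuki2012, status: disputed] -/
theorem mem_thetaIndexOfInitial_Vbad_iff (v : ↥D.V) :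
    v ∈ (thetaIndexOfInitial D).Vbad ↔ toVMod F K E (v : Val K) ∈ Val.non '' D.VbadMod :=
  ⟨fun h => h.2, fun h => ⟨v.2, h⟩⟩

/-- At a bad place the residue characteristic below is ODD (Def. 3.1 (b)) and different from `l`
(Def. 3.1 (c)) — L5-t2's `VbadMod_odd` / `l_ne_residueChar` read on the instance.
[claim: Mochizuki2012, status: disputed] -/
theorem residueChar_odd_and_ne_of_mem_Vbad (v : ↥D.V) (hv : v ∈ (thetaIndexOfInitial D).Vbad) :
    ∃ w ∈ D.VbadMod, toVMod F K E (v : Val K) = Val.non w ∧ Odd (residueChar w) ∧ residueChar w ≠ l := by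
  obtain ⟨w, hw, hwv⟩ := (mem_thetaIndexOfInitial_Vbad_iff D v).mp hv
  exact ⟨w, hw, hwv.symm, D.VbadMod_odd w hw, D.l_ne_residueChar w hw⟩

/-- NON-VACUITY of the instantiated index skeleton: `V^bad` is inhabited. [folklore] -/
theorem thetaIndexOfInitial_Vbad_nonempty : (thetaIndexOfInitial D).Vbad.Nonempty :=
  (thetaIndexOfInitial D).Vbad_nonempty

end OfInitial

/-! ## 3. The log-shell carriers `K_v`, `v ∈ V̲`, over the M-level index skeleton -/

section ShellsOfInitial

open Literature.IUT.LogVolume Literature.IUT.LogThetaLattice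

variable {K : Type} [Field K] [NumberField K]

/-- The local field `K_v` at a valuation `v ∈ V(K)` (L5-t1's `Val K`): Mathlib's completion at an
archimedean place, resp. the adic completion at the prime of a finite place. [folklore] -/
def CarrierVal : Val K → Type
  | .inl w => w.Completion
  | .inr w => (FinitePlace.maximalIdeal w).adicCompletion K

/-- `K_v` is a complete normed field. [folklore] -/
instance instNormedFieldCarrierVal : ∀ v : Val K, NormedField (CarrierVal v)
  | .inl w => inferInstanceAs (NormedField w.Completion)
  | .inr w => inferInstanceAs (NormedField ((FinitePlace.maximalIdeal w).adicCompletion K))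

/-- `K_v` is a `K`-algebra. [folklore] -/
instance instAlgebraCarrierVal : ∀ v : Val K, Algebra K (CarrierVal v)
  | .inl w => inferInstanceAs (Algebra K w.Completion)
  | .inr w => inferInstanceAs (Algebra K ((FinitePlace.maximalIdeal w).adicCompletion K))

/-- `K_v` has characteristic `0`. [folklore] -/
instance instCharZeroCarrierVal (v : Val K) : CharZero (CarrierVal v) :=
  charZero_of_injective_algebraMap (algebraMap K (CarrierVal v)).injective

/-- `O_v ⊆ K_v` at a finite place. [folklore] -/
abbrev integersVal (w : FinitePlace K) : ValuationSubring (CarrierVal (Val.non w)) :=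
  (FinitePlace.maximalIdeal w).adicCompletionIntegers K

/-- A family of `p_v`-adic logarithms on units, one per finite place of `K` (BINDER type; abc-iut-S1's
`unitLog` once `K_v` carries its `ℚ_[p]`-algebra structure). [folklore] -/
abbrev PadicLogsVal (K : Type) [Field K] [NumberField K] : Type :=
  ∀ w : FinitePlace K, Additive (↥(integersVal (K := K) w))ˣ →+ CarrierVal (Val.non w)

/-- The log-shell `I_v ⊆ K_v`: `(p_v^*)⁻¹·log_v(O_v^×)` at a finite place (abc-iut-L6-t3's `nonarchLogShell`,
[IUTchIII] Rmk. 1.2.2 (i); `p_v` = abc-iut-c312-3's `residueChar`), `{|a| ≤ π}` at an archimedean place (preimage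
of L6-t3's `arcLogShell` under `extensionEmbedding : K_v →+* ℂ`, Rmk. 1.2.2 (ii)). [claim: Mochizuki2012, status: disputed] -/
def shellVal (logv : PadicLogsVal K) : ∀ v : Val K, Set (CarrierVal v)
  | .inl w => (InfinitePlace.Completion.extensionEmbedding w) ⁻¹' arcLogShell
  | .inr w => nonarchLogShell (integersVal w) (logv w) (residueChar K (FinitePlace.maximalIdeal w))

variable {F Fbar : Type} [Field F] [NumberField F] [Algebra F K] [Field Fbar] [Algebra F Fbar]
  [Algebra K Fbar] {E : WeierstrassCurve F} [E.IsElliptic] {l : ℕ} {P : BadPlacePredicates K}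
  (D : InitialThetaData F K Fbar E l P)

/-- **`Thm311.LogShells` over the M-level index skeleton** `Real.thetaIndexOfInitial D`: carriers
`log(D⊢_v) := K_v` for `v ∈ V̲` (the section of [IUTchI] Def. 3.1 (e)), shells `Real.shellVal`, and the two
automorphism families of [IUTchIII] Thm. 3.11 (i) as the BINDERS `Aut`, `Ism` (owners as in `Thm311Real`).
[claim: Mochizuki2012, status: disputed] -/
def logShellsOfInitial (logv : PadicLogsVal K)
    (Aut Ism : ∀ v : ↥D.V, Set (CarrierVal v.1 ≃ₗ[ℚ] CarrierVal v.1))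
    (hAut : ∀ v, LinearEquiv.refl ℚ _ ∈ Aut v) (hIsm : ∀ v, LinearEquiv.refl ℚ _ ∈ Ism v) :
    LogShells (thetaIndexOfInitial D) where
  carrier v := CarrierVal (v : ↥D.V).1
  shell v := shellVal logv (v : ↥D.V).1
  stripAut := Aut
  ism := Ism
  one_mem_stripAut := hAut
  one_mem_ism := hIsm

/-- The carrier of the M-level instance at `v ∈ V̲` is `K_v`. [folklore] -/
theorem logShellsOfInitial_carrier (logv : PadicLogsVal K)
    (Aut Ism : ∀ v : ↥D.V, Set (CarrierVal v.1 ≃ₗ[ℚ] CarrierVal v.1))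
    (hAut : ∀ v, LinearEquiv.refl ℚ _ ∈ Aut v) (hIsm : ∀ v, LinearEquiv.refl ℚ _ ∈ Ism v) (v : ↥D.V) :
    (logShellsOfInitial D logv Aut Ism hAut hIsm).carrier v = CarrierVal v.1 := rfl

/-- (c^non) for the M-level instance: `log_v(O_v^×) ⊆ I_v` at every finite place (abc-iut-L6-t3's
`log_mem_nonarchLogShell`; `p_v^* ≠ 0` in characteristic `0`). [claim: Mochizuki2012, status: disputed] -/
theorem log_mem_shellVal (logv : PadicLogsVal K) (w : FinitePlace K) (x : (↥(integersVal w))ˣ) :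
    logv w (Additive.ofMul x) ∈ shellVal logv (Val.non w) := by
  refine log_mem_nonarchLogShell (integersVal w) (logv w) _ ?_ x
  exact Nat.cast_ne_zero.mpr (pStar_ne_zero (residueChar_prime K _).ne_zero)

end ShellsOfInitial

end Summit.ABC.IUTFork.Thm311.Real

end
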